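import Literature.Geometry.Kaehler.CechDeRhamTransgression
import Literature.NumberTheory.Transcendental.ComplexFormsProofs
import HarnessLib

/-!
# The transgressed class is well defined: zig-zags of one cochain have cohomologous bottoms

Theorems file of route `MilnorKExponential` of the Hodge summit, crux `SymbolLiftR`
(stmt-HodgeConjecture-18702), line `lefschetz-fold`, kernel `stub_primitiveLiftExists` (LIFT_p for
primitive rational `(p,p)` classes, `2 ≤ p ≤ n/2`).

`HodgeModel.HasSymbolCocycle q c` ends with the identity `A.deRham [θ] = m • A^* c` for SOME
transgression `θ` of the symbol forms of a Milnor cocycle. The companion file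
`…SymbolLiftRTransgression` shows that a transgression always exists; this file shows that its de
Rham class does not depend on the zig-zag chosen, so that a prover of the kernel may compute the
class with the most convenient staircase (e.g. the explicit constant-coefficient staircase of an
Appell–Humbert cocycle on a torus) and conclude for every other one:

* `exists_dA_eq_of_zero_staircase` — in an anticommuting double complex with exact rows and an
  exact row augmentation `ε : A → K^{0,•}` (Weibel's setting), a staircase whose TOP is `δ`-closed to
  zero (`δ Z_{q,q+1} = 0`) has a bottom `ε θ = d Z_{0,2q+1}` that is a boundary of the augmentation:
  `θ = d_A η` (descending induction: `Z_{q,q+1} = δ Y`, then `Z_{a,b} + d(correction) ∈ im δ` at each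
  level by `δ d = -d δ`, `d d = 0`, down to the column `0`, where `ε` is injective with image `ker δ₀`);
* `IsTransgression.exists_mextDeriv_eq_of_zero` — on a manifold with a smooth partition of unity
  subordinate to the finite open cover, a transgression of the ZERO cochain is EXACT: `θ = dη` for a
  smooth global `η` (Bott–Tu (1982), Prop. 8.8: `H_D{C^•(𝔘, Ω^•)} ≅ H_dR(M)` is injective);
* `IsTransgression.sub_mem_exactSmoothForms` — two transgressions `θ₁`, `θ₂` of the same cochain
  `w` differ by an exact form; `IsTransgression.mk_eq_mk` — hence they define the SAME complex
  de Rham class (`complexDeRhamCohomology.mk`), and `IsTransgression.mk_eq_mk_of_cover` on a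
  σ-compact Hausdorff manifold, where the partition of unity exists.

References: R. Bott, L. W. Tu, *Differential Forms in Algebraic Topology* (1982), Prop. 8.5 and
Prop. 8.8; C. A. Weibel, *An Introduction to Homological Algebra* (1994), 1.2.5 and Lemma 2.7.3.
-/

noncomputable section

-- The mandated namespace repeats `HodgeConjecture` (single-conjunct summit).
set_option linter.dupNamespace false

open scoped Manifold Topology ContDiff
open Set Function Filter

namespace Summit.HodgeConjecture.HodgeConjecture.Theorems.SymbolLiftR

open Literature.Algebra.Homology Literature.Geometry.Kaehler Literature.NumberTheory.Transcendental

/-! ### A staircase with zero top has an exact bottom (abstract double complex) -/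

section Staircase

variable {R : Type*} [CommRing R] {X : ℕ → ℕ → Type*} [∀ p q, AddCommGroup (X p q)]
  [∀ p q, Module R (X p q)] {A : ℕ → Type*} [∀ n, AddCommGroup (A n)] [∀ n, Module R (A n)]

/-- **A staircase with `δ`-closed-to-zero top has a bottom that is a boundary of the augmentation.**
Let `K` be an anticommuting double complex with exact rows, `ε : A^• → K^{0,•}` an exact row
augmentation (injective, image `ker δ₀`), and `Z_{a,b}` a staircase: `δ Z_{q,q+1} = 0`,
`d Z_{a+1,b} = δ Z_{a,b+1}` for `a + 1 + b = 2q + 1`, `a < q`, and `ε θ = d Z_{0,2q+1}`. Then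
`θ = d_A η` for some `η ∈ A^{2q+1}`. This is the injectivity half of Bott–Tu (1982), Prop. 8.8 /
Weibel (1994), Lemma 2.7.3, along the staircase: inductively `Z_{a,b'+1} + d y ∈ ker δ = im δ`
(`δ d = -d δ`, `d d = 0`), and in the column `0`, `Z_{0,2q+1} + d y = ε η`, whence
`ε (d_A η) = d (ε η) = d Z_{0,2q+1} = ε θ`. [cite: BottTu1982Forms, §8 Prop. 8.8] -/
theorem exists_dA_eq_of_zero_staircase (K : ADoubleComplex R X) (hK : K.RowExact)
    (E : K.RowAugmentation A) (hE : E.Exact) (q : ℕ) (Z : (a b : ℕ) → X a b)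
    (htop : K.δ q (q + 1) (Z q (q + 1)) = 0)
    (hsteps : ∀ a b : ℕ, a + 1 + b = 2 * q + 1 → a < q →
      K.d (a + 1) b (Z (a + 1) b) = K.δ a (b + 1) (Z a (b + 1)))
    (θ : A (2 * q + 1 + 1)) (hbot : E.ε (2 * q + 1 + 1) θ = K.d 0 (2 * q + 1) (Z 0 (2 * q + 1))) :
    ∃ η : A (2 * q + 1), E.dA (2 * q + 1) η = θ := by
  -- Claim(k): at level `a = q - k`, `Z_{a,b'+1} + d y` is `δ`-closed for some correction `y`.
  have claim : ∀ k : ℕ, k ≤ q → ∀ a b' : ℕ, a + k = q → a + b' = 2 * q →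
      ∃ y : X a b', K.δ a (b' + 1) (Z a (b' + 1) + K.d a b' y) = 0 := by
    intro k
    induction k with
    | zero =>
      intro _ a b' hak hab
      obtain rfl : q = a := by omega
      obtain rfl : q = b' := by omega
      exact ⟨0, by rw [map_zero, add_zero]; exact htop⟩
    | succ k ih =>
      intro hk a b' hak hab
      obtain ⟨b, rfl⟩ : ∃ b, b' = b + 1 := ⟨b' - 1, by omega⟩
      obtain ⟨y₁, hy₁⟩ := ih (Nat.le_of_succ_le hk) (a + 1) b (by omega) (by omega)
      obtain ⟨u, hu⟩ := hK.exact a (b + 1) _ hy₁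
      refine ⟨u, ?_⟩
      rw [map_add, K.δ_d, hu, map_add, K.d_d, add_zero, ← hsteps a (b + 1) (by omega) (by omega),
        add_neg_cancel]
  obtain ⟨y, hy⟩ := claim q le_rfl 0 (2 * q) (by omega) (by omega)
  obtain ⟨η, hη⟩ := hE.exact (2 * q + 1) _ hy
  refine ⟨η, hE.injective (2 * q + 1 + 1) ?_⟩
  rw [E.ε_dA, hη, map_add, K.d_d, add_zero, hbot]

end Staircase

/-! ### Transgressions of the zero cochain are exact; the transgressed class is well defined -/

section Transgression

variable {E : Type*} [NormedAddCommGroup E] [NormedSpace ℝ E]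
  {H : Type*} [TopologicalSpace H] {I : ModelWithCorners ℝ E H}
  {M : Type*} [TopologicalSpace M] [ChartedSpace H M]
  {F : Type*} [NormedAddCommGroup F] [NormedSpace ℝ F]
  {ι : Type*} [IsManifold I ∞ M] {U : ι → Set M} {hU : ∀ i, IsOpen (U i)} {q : ℕ}

/-- **A transgression of the zero cochain is exact** (injectivity of `H_D{C^•(𝔘, Ω^•)} → H_dR(M)`
along the staircase, Bott–Tu (1982), Prop. 8.8). On a manifold with a smooth partition of unity
subordinate to the finite open cover `𝔘`: if `θ` is reached by a Čech–de Rham zig-zag from the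
cochain `w = 0`, then `θ = dη` for a smooth global `(2q+1)`-form `η`. [cite: BottTu1982Forms, §8 Prop. 8.8] -/
theorem _root_.Literature.Geometry.Kaehler.IsTransgression.exists_mextDeriv_eq_of_zero [Fintype ι]
    (ρ : SmoothPartitionOfUnity ι I M univ) (hρ : ρ.IsSubordinate U) (hcov : ∀ y : M, ∃ i, y ∈ U i)
    {θ : MForm I M F (2 * q + 1 + 1)}
    (h : IsTransgression hU q (0 : (Fin (q + 2) → ι) → MForm I M F (q + 1)) θ) :
    ∃ η : MForm I M F (2 * q + 1), IsSmoothForm η ∧ mextDeriv η = θ := by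
  have hθs : IsSmoothForm θ := h.isSmoothForm hcov
  obtain ⟨Z, htop, hsteps, hbot⟩ := h
  -- the top `δ Z_{q,q+1}` vanishes as a cochain
  have htop' : cechδ I F hU q (q + 1) (Z q (q + 1)) = 0 := by
    funext J
    apply Subtype.ext
    funext x
    by_cases hx : x ∈ cechSet U J
    · rw [htop J x hx]
      rfl
    · rw [(cechδ I F hU q (q + 1) (Z q (q + 1)) J).2.2 x hx]
      rfl
  -- the bottom, as an element of the augmentation `Ω^{2q+2}(M)`
  have hθmem : θ ∈ smoothFormsOn I F (univ : Set M) (2 * q + 1 + 1) :=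
    ⟨fun x _ ↦ hθs x, fun x hx ↦ (hx (mem_univ x)).elim⟩
  have hbot' : (cechDeRhamRow I F hU).ε (2 * q + 1 + 1) ⟨θ, hθmem⟩ =
      cechd I F hU 0 (2 * q + 1) (Z 0 (2 * q + 1)) := by
    funext J
    apply Subtype.ext
    rw [coe_cechDeRhamRow_ε]
    funext x
    by_cases hx : x ∈ cechSet U J
    · rw [MForm.restr_apply_of_mem _ hx]
      exact (hbot J x hx).symm
    · rw [MForm.restr_apply_of_notMem _ hx, (cechd I F hU 0 (2 * q + 1) (Z 0 (2 * q + 1)) J).2.2 x hx]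
  obtain ⟨η, hη⟩ := exists_dA_eq_of_zero_staircase (cechDeRham I F hU) (cechDeRham_rowExact hU ρ hρ)
    (cechDeRhamRow I F hU) (cechDeRhamRow_exact hU ρ hρ hcov) q Z htop' hsteps ⟨θ, hθmem⟩ hbot'
  refine ⟨(η : MForm I M F (2 * q + 1)), fun x ↦ η.2.1 x (mem_univ x), ?_⟩
  have h' := congrArg (fun a : smoothFormsOn I F (univ : Set M) (2 * q + 1 + 1) ↦
    (a : MForm I M F (2 * q + 1 + 1))) hη
  simp only at h'
  change ((mextDeriv (η : MForm I M F (2 * q + 1))).restr univ) = θ at h'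
  rwa [MForm.restr_univ] at h'

/-- **Two transgressions of the same cochain differ by an exact form.** [cite: BottTu1982Forms, §8 Prop. 8.8] -/
theorem _root_.Literature.Geometry.Kaehler.IsTransgression.sub_mem_exactSmoothForms [Fintype ι]
    (ρ : SmoothPartitionOfUnity ι I M univ) (hρ : ρ.IsSubordinate U) (hcov : ∀ y : M, ∃ i, y ∈ U i)
    {w : (Fin (q + 2) → ι) → MForm I M F (q + 1)} {θ₁ θ₂ : MForm I M F (2 * q + 1 + 1)}
    (h₁ : IsTransgression hU q w θ₁) (h₂ : IsTransgression hU q w θ₂) :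
    θ₁ - θ₂ ∈ exactSmoothForms I M F (2 * q + 1 + 1) := by
  have h := h₁.sub h₂
  rw [sub_self] at h
  obtain ⟨η, hηs, hη⟩ := h.exists_mextDeriv_eq_of_zero ρ hρ hcov
  simp only [exactSmoothForms]
  exact Submodule.subset_span ⟨η, (mem_smoothForms_iff η).2 hηs, hη⟩

/-- The same on a σ-compact Hausdorff manifold over a finite-dimensional model, where the
partition of unity exists (`SmoothPartitionOfUnity.exists_isSubordinate`). [cite: BottTu1982Forms, §8 Prop. 8.8] -/
theorem _root_.Literature.Geometry.Kaehler.IsTransgression.sub_mem_exactSmoothForms_of_cover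
    [FiniteDimensional ℝ E] [T2Space M] [SigmaCompactSpace M] [Fintype ι]
    (hcov : ∀ y : M, ∃ i, y ∈ U i)
    {w : (Fin (q + 2) → ι) → MForm I M F (q + 1)} {θ₁ θ₂ : MForm I M F (2 * q + 1 + 1)}
    (h₁ : IsTransgression hU q w θ₁) (h₂ : IsTransgression hU q w θ₂) :
    θ₁ - θ₂ ∈ exactSmoothForms I M F (2 * q + 1 + 1) := by
  have hsub : (univ : Set M) ⊆ ⋃ i, U i := fun y _ ↦ mem_iUnion.2 (hcov y)
  obtain ⟨ρ, hρ⟩ := SmoothPartitionOfUnity.exists_isSubordinate I isClosed_univ U hU hsub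
  exact h₁.sub_mem_exactSmoothForms ρ hρ hcov h₂

end Transgression

/-! ### Complex coefficients: the complex de Rham class of a transgression -/

section Complex

variable {E : Type*} [NormedAddCommGroup E] [NormedSpace ℂ E]
  {M : Type*} [TopologicalSpace M] [ChartedSpace E M] [IsManifold 𝓘(ℝ, E) ∞ M]
  {ι : Type*} {U : ι → Set M} {hU : ∀ i, IsOpen (U i)} {q : ℕ}

/-- **The complex de Rham class of a transgression depends only on the cochain.** If the closed
smooth complex forms `θ₁`, `θ₂` are both reached by Čech–de Rham zig-zags from the same cochain
`w` (on a complex manifold with a smooth partition of unity subordinate to the finite open cover),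
then `[θ₁] = [θ₂]` in `H^{2q+2}_dR(M; ℂ)` (`complexDeRhamCohomology.mk`). In particular the class
attached by `HodgeModel.HasSymbolCocycle` to a Milnor symbol cocycle may be computed with ANY
convenient zig-zag. [cite: BottTu1982Forms, §8 Prop. 8.8] -/
theorem _root_.Literature.Geometry.Kaehler.IsTransgression.mk_eq_mk [Fintype ι]
    (ρ : SmoothPartitionOfUnity ι 𝓘(ℝ, E) M univ) (hρ : ρ.IsSubordinate U) (hcov : ∀ y : M, ∃ i, y ∈ U i)
    {w : (Fin (q + 2) → ι) → MForm 𝓘(ℝ, E) M ℂ (q + 1)}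
    {θ₁ θ₂ : cclosedSmoothForms E M (2 * q + 1 + 1)}
    (h₁ : IsTransgression hU q w (θ₁ : MForm 𝓘(ℝ, E) M ℂ _))
    (h₂ : IsTransgression hU q w (θ₂ : MForm 𝓘(ℝ, E) M ℂ _)) :
    complexDeRhamCohomology.mk E M (2 * q + 1 + 1) θ₁ = complexDeRhamCohomology.mk E M (2 * q + 1 + 1) θ₂ :=
  (complexDeRhamCohomology.mk_eq_mk_iff_mem_exactSmoothForms θ₁ θ₂).2
    (h₁.sub_mem_exactSmoothForms ρ hρ hcov h₂)

/-- The same on a σ-compact Hausdorff complex manifold (finite-dimensional model), where the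
partition of unity exists — e.g. on the carrier of a Hodge model of a smooth projective variety.
[cite: BottTu1982Forms, §8 Prop. 8.8] -/
theorem _root_.Literature.Geometry.Kaehler.IsTransgression.mk_eq_mk_of_cover
    [FiniteDimensional ℂ E] [T2Space M] [SigmaCompactSpace M] [Fintype ι]
    (hcov : ∀ y : M, ∃ i, y ∈ U i)
    {w : (Fin (q + 2) → ι) → MForm 𝓘(ℝ, E) M ℂ (q + 1)}
    {θ₁ θ₂ : cclosedSmoothForms E M (2 * q + 1 + 1)}
    (h₁ : IsTransgression hU q w (θ₁ : MForm 𝓘(ℝ, E) M ℂ _))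
    (h₂ : IsTransgression hU q w (θ₂ : MForm 𝓘(ℝ, E) M ℂ _)) :
    complexDeRhamCohomology.mk E M (2 * q + 1 + 1) θ₁ = complexDeRhamCohomology.mk E M (2 * q + 1 + 1) θ₂ :=
  (complexDeRhamCohomology.mk_eq_mk_iff_mem_exactSmoothForms θ₁ θ₂).2
    (h₁.sub_mem_exactSmoothForms_of_cover hcov h₂)

end Complex

/-- STUB `stub_isTransgression_mk_eq_mk` (helper sub-goal registered on stmt-HodgeConjecture-18702
for the kernel `stub_primitiveLiftExists`: the complex de Rham class of a transgression depends
only on the transgressed cochain, so the class clause of `HasSymbolCocycle` may be computed with any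
zig-zag): `IsTransgression.mk_eq_mk_of_cover`, stated closed. [cite: BottTu1982Forms, §8 Prop. 8.8] -/
theorem stub_isTransgression_mk_eq_mk : ∀ {E : Type*} [NormedAddCommGroup E] [NormedSpace ℂ E] {M : Type*} [TopologicalSpace M] [ChartedSpace E M] [IsManifold 𝓘(ℝ, E) ∞ M] {ι : Type*} {U : ι → Set M} {hU : ∀ i, IsOpen (U i)} {q : ℕ} [FiniteDimensional ℂ E] [T2Space M] [SigmaCompactSpace M] [Fintype ι], (∀ y : M, ∃ i, y ∈ U i) → ∀ {w : (Fin (q + 2) → ι) → MForm 𝓘(ℝ, E) M ℂ (q + 1)} {θ₁ θ₂ : cclosedSmoothForms E M (2 * q + 1 + 1)}, IsTransgression hU q w (θ₁ : MForm 𝓘(ℝ, E) M ℂ _) → IsTransgression hU q w (θ₂ : MForm 𝓘(ℝ, E) M ℂ _) → complexDeRhamCohomology.mk E M (2 * q + 1 + 1) θ₁ = complexDeRhamCohomology.mk E M (2 * q + 1 + 1) θ₂ :=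
  fun hcov _ _ _ h₁ h₂ ↦ h₁.mk_eq_mk_of_cover hcov h₂

end Summit.HodgeConjecture.HodgeConjecture.Theorems.SymbolLiftR

end
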